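import Literature.Analysis.FunctionSpaces.TorusFourierCalculus
import Literature.Analysis.FunctionSpaces.TorusVectorParseval
import Literature.Analysis.FunctionSpaces.TorusTestFunction
import HarnessLib

/-!
# Weak derivatives on `T^d` read off the Fourier coefficients

Grafakos 2014, Prop. 3.2.6 (8): for `φ ∈ C¹(T^n)`, `𝓕(∂ⱼφ)(m) = 2πi mⱼ φ̂(m)`. Read backwards
through the polarised Parseval identity (Prop. 3.2.7 (3)), it says that an `L²` function `g` whose
Fourier coefficients are `ĝ(k) = 2πi kⱼ v̂(k)` **is the weak `j`-th partial derivative of `v`**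
in the sense of `Torus.HasWeakPartialDeriv` (Evans, §5.2.1: `∫ ∂ⱼφ v = -∫ φ g` for all smooth
`φ`), and that `‖g‖²_{L²} = 4π² ∑ₖ kⱼ² |v̂(k)|²`. This is the slice-wise half of the passage from
the spectral class `L²(0,T; H¹(T^d))` (`Torus.MemL2Sobolev 0 T 1`) of Leray–Hopf solutions to
honest weak gradients in `L²` (Temam, Ch. III §1.1; the jointly measurable choice of `g` is
`Torus.exists_aestronglyMeasurable_mFourierCoeff_eq` in `TorusParamRieszFischer`).

## Contents (all for the global `volume` of H21 and real vector fields through `complexify`)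

* `Torus.ae_eq_zero_of_forall_integral_mul_eq_zero` — an `L²` real function orthogonal to all
  smooth real test functions vanishes a.e. (its complexification has vanishing Fourier
  coefficients — the characters have smooth real and imaginary parts — and Parseval);
* `Torus.ofReal_integral_partialDeriv_mul_eq` — for real `v ∈ L²`, complex `g ∈ L²` with
  `ĝ(k) = 2πi kⱼ v̂(k)`: `∫ ∂ⱼφ v = -∫ φ g` (in `ℂ`) for smooth real `φ`; hence
  `Torus.integral_partialDeriv_mul_eq_neg_integral_mul_re` (real parts) and
  `Torus.im_ae_eq_zero_of_mFourierCoeff` (`g` is a.e. real);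
* `Torus.hasWeakPartialDeriv_of_mFourierCoeff` — vector form: for `v ∈ L²(T^d; ℝ^d)` and
  `gᵢ ∈ L²` with `ĝᵢ(k) = 2πi kⱼ v̂ᵢ(k)`, the field `x ↦ (Re gᵢ(x))ᵢ` is a weak `j`-th partial
  derivative of `v`;
* `Torus.tsum_enorm_sq_mFourierCoeff` — scalar Parseval in `ℝ≥0∞` for `L²` functions;
* `Torus.lintegral_sum_enorm_sq_eq_eGradNormSq` — `∫ ∑ᵢⱼ ‖gᵢⱼ‖² = eGradNormSq v` when
  `ĝᵢⱼ(k) = 2πi kⱼ v̂ᵢ(k)` (the spectral dissipation `4π² ∑ₖ |k|² ‖v̂(k)‖²` is the `L²` mass of the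
  weak gradient).

## References

* L. Grafakos, *Classical Fourier Analysis*, 3rd ed., GTM 249 (Springer 2014), Prop. 3.2.6 (8),
  Prop. 3.2.7 (3). [Grafakos2014]
* L. C. Evans, *Partial Differential Equations*, 2nd ed. (AMS 2010), §5.2.1 (weak derivatives),
  §5.8.4 Thm. 8 (characterisation of `H^k` by Fourier transform). [Evans2010]
* R. Temam, *Navier–Stokes Equations*, 3rd ed. (North-Holland 1984), Ch. III §1.1.
-/

open MeasureTheory Set Filter Topology UnitAddTorus
open scoped ENNReal NNReal ComplexConjugate

noncomputable section

namespace Literature.Analysis.FunctionSpaces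

namespace Torus

variable {d : Type*} [Fintype d]

/-! ## Vanishing against smooth test functions -/

section Vanishing

/-- The integrand of a Fourier coefficient of a real function splits into real and imaginary
parts: `e_{-k}(x) h(x) = (Re e_{-k}(x)) h(x) + i (Im e_{-k}(x)) h(x)`. [folklore] -/
theorem mFourier_smul_ofReal (k : d → ℤ) (h : UnitAddTorus d → ℝ) (x : UnitAddTorus d) :
    mFourier k x • ((h x : ℝ) : ℂ) =
      (((mFourier k x).re * h x : ℝ) : ℂ) + (((mFourier k x).im * h x : ℝ) : ℂ) * Complex.I := by
  apply Complex.ext <;> simp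

/-- **An `L²` real function orthogonal to all smooth real test functions vanishes a.e.**
(du Bois-Reymond on `T^d`; Evans, §5.2.1). Proof: the characters have smooth real and imaginary
parts, so all Fourier coefficients of the complexified function vanish, and Parseval
(`Torus.hasSum_sq_norm_mFourierCoeff`) gives `∫ h² = 0`. [folklore] -/
theorem ae_eq_zero_of_forall_integral_mul_eq_zero {h : UnitAddTorus d → ℝ} (hh : MemLp h 2 volume)
    (H : ∀ φ : UnitAddTorus d → ℝ, IsSmooth φ → ∫ x, φ x * h x = 0) : h =ᵐ[volume] 0 := by
  haveI : IsFiniteMeasure (volume : Measure (UnitAddTorus d)) := inferInstance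
  have hhi : Integrable h volume := hh.integrable one_le_two
  set hc : UnitAddTorus d → ℂ := fun x => (h x : ℂ) with hc_def
  have hcL2 : MemLp hc 2 volume := Complex.ofRealCLM.comp_memLp' hh
  have hcoeff : ∀ k, mFourierCoeff hc k = 0 := by
    intro k
    rw [mFourierCoeff_eq_integral_volume]
    have hre : IsSmooth (fun x => (mFourier (-k) x).re) :=
      (isSmooth_mFourier (-k)).comp_clm Complex.reCLM
    have him : IsSmooth (fun x => (mFourier (-k) x).im) :=
      (isSmooth_mFourier (-k)).comp_clm Complex.imCLM
    have h1 : Integrable (fun x => (((mFourier (-k) x).re * h x : ℝ) : ℂ)) volume :=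
      (hre.integrable_smul hhi).ofReal
    have h2 : Integrable (fun x => (((mFourier (-k) x).im * h x : ℝ) : ℂ) * Complex.I) volume :=
      (him.integrable_smul hhi).ofReal.mul_const _
    simp_rw [hc_def, mFourier_smul_ofReal]
    rw [integral_add h1 h2, integral_mul_const, integral_complex_ofReal, integral_complex_ofReal,
      H _ hre, H _ him]
    simp
  have hP := hasSum_sq_norm_mFourierCoeff hcL2
  simp only [hcoeff, norm_zero, ne_eq, OfNat.ofNat_ne_zero, not_false_eq_true, zero_pow] at hP
  have h0 : ∫ x, ‖hc x‖ ^ 2 = 0 := hP.unique hasSum_zero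
  have h0' : ∫ x, h x ^ 2 = 0 := by
    rw [← h0]
    refine integral_congr_ae (ae_of_all _ fun x => ?_)
    simp [hc_def, Complex.norm_real, sq_abs]
  have hsq : (fun x => h x ^ 2) =ᵐ[volume] 0 :=
    (integral_eq_zero_iff_of_nonneg (fun x => sq_nonneg (h x)) hh.integrable_sq).1 h0'
  filter_upwards [hsq] with x hx
  simpa using hx

end Vanishing

/-! ## The weak derivative identity from `ĝ(k) = 2πi kⱼ v̂(k)` -/

section WeakDeriv

variable [DecidableEq d]

omit [DecidableEq d] in
/-- The complexification `x ↦ (φ x : ℂ)` of a smooth real function is smooth. [folklore] -/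
theorem IsSmooth.ofReal_comp {φ : UnitAddTorus d → ℝ} (hφ : IsSmooth φ) :
    IsSmooth (fun x => (φ x : ℂ)) :=
  hφ.comp_clm Complex.ofRealCLM

/-- `∂ⱼ (φ : ℂ) = (∂ⱼ φ : ℂ)` for smooth real `φ`. [folklore] -/
theorem partialDeriv_ofReal_comp {φ : UnitAddTorus d → ℝ} (hφ : IsSmooth φ) (j : d)
    (x : UnitAddTorus d) :
    partialDeriv j (fun y => (φ y : ℂ)) x = ((partialDeriv j φ x : ℝ) : ℂ) :=
  partialDeriv_clm_comp hφ Complex.ofRealCLM j x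

/-- **The weak derivative identity read off the Fourier side** (Grafakos 2014, Prop. 3.2.6 (8)
with the polarised Parseval identity Prop. 3.2.7 (3)): if `v ∈ L²(T^d; ℝ)`, `g ∈ L²(T^d; ℂ)`
and `ĝ(k) = 2πi kⱼ v̂(k)` for all `k`, then `∫ ∂ⱼφ · v = -∫ φ · g` for every smooth real `φ`
(as complex numbers). Indeed both sides equal `∑ₖ conj(2πi kⱼ φ̂(k)) v̂(k)`. [cite: Grafakos2014, Prop. 3.2.6 (8)] -/
theorem ofReal_integral_partialDeriv_mul_eq {v : UnitAddTorus d → ℝ} (hv : MemLp v 2 volume)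
    {g : UnitAddTorus d → ℂ} (hg : MemLp g 2 volume) (j : d)
    (hcoeff : ∀ k : d → ℤ, mFourierCoeff g k =
      (2 * Real.pi * Complex.I * (k j) : ℂ) * mFourierCoeff (fun x => (v x : ℂ)) k)
    {φ : UnitAddTorus d → ℝ} (hφ : IsSmooth φ) :
    ((∫ x, partialDeriv j φ x * v x : ℝ) : ℂ) = -∫ x, (φ x : ℂ) * g x := by
  have hΦ : IsSmooth (fun x => (φ x : ℂ)) := hφ.ofReal_comp
  have hdΦ : partialDeriv j (fun y => (φ y : ℂ)) = fun x => ((partialDeriv j φ x : ℝ) : ℂ) :=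
    funext (partialDeriv_ofReal_comp hφ j)
  have hvC : MemLp (fun x => (v x : ℂ)) 2 volume := Complex.ofRealCLM.comp_memLp' hv
  -- Parseval, polarised, for the pairs `(∂ⱼΦ, v)` and `(Φ, g)`
  have h1 := hasSum_conj_mul_mFourierCoeff ((hΦ.partialDeriv j).memLp 2) hvC
  have h2 := (hasSum_conj_mul_mFourierCoeff (hΦ.memLp 2) hg).neg
  -- identify the values
  have hval1 : ∫ x, conj (partialDeriv j (fun y => (φ y : ℂ)) x) * (v x : ℂ) =
      ((∫ x, partialDeriv j φ x * v x : ℝ) : ℂ) := by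
    rw [← integral_complex_ofReal]
    refine integral_congr_ae (ae_of_all _ fun x => ?_)
    simp [hdΦ]
  have hval2 : ∫ x, conj ((φ x : ℂ)) * g x = ∫ x, (φ x : ℂ) * g x := by
    refine integral_congr_ae (ae_of_all _ fun x => ?_)
    simp [Complex.conj_ofReal]
  rw [hval1] at h1
  rw [hval2] at h2
  -- identify the terms
  refine h1.unique (h2.congr_fun fun k => ?_)
  rw [hcoeff k, mFourierCoeff_partialDeriv hΦ j k]
  simp only [smul_eq_mul, map_mul, Complex.conj_ofReal, Complex.conj_I, map_intCast, map_ofNat]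
  ring

/-- Real parts of `ofReal_integral_partialDeriv_mul_eq`: `∫ ∂ⱼφ · v = -∫ φ · Re g` for every
smooth real `φ`, i.e. `Re g` is a weak `j`-th partial derivative of `v` (Evans, §5.2.1). [folklore] -/
theorem integral_partialDeriv_mul_eq_neg_integral_mul_re {v : UnitAddTorus d → ℝ}
    (hv : MemLp v 2 volume) {g : UnitAddTorus d → ℂ} (hg : MemLp g 2 volume) (j : d)
    (hcoeff : ∀ k : d → ℤ, mFourierCoeff g k =
      (2 * Real.pi * Complex.I * (k j) : ℂ) * mFourierCoeff (fun x => (v x : ℂ)) k)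
    {φ : UnitAddTorus d → ℝ} (hφ : IsSmooth φ) :
    ∫ x, partialDeriv j φ x * v x = -∫ x, φ x * (g x).re := by
  haveI : IsFiniteMeasure (volume : Measure (UnitAddTorus d)) := inferInstance
  have h := congrArg Complex.re (ofReal_integral_partialDeriv_mul_eq hv hg j hcoeff hφ)
  have hint : Integrable (fun x => (φ x : ℂ) * g x) volume := by
    have := hφ.integrable_smul (hg.integrable one_le_two)
    simpa [Complex.real_smul] using this
  rw [Complex.ofReal_re, Complex.neg_re, ← RCLike.re_eq_complex_re, ← integral_re hint] at h
  rw [h]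
  congr 1
  refine integral_congr_ae (ae_of_all _ fun x => ?_)
  simp

/-- Imaginary parts of `ofReal_integral_partialDeriv_mul_eq`: `∫ φ · Im g = 0` for every smooth
real `φ`, hence **`g` is a.e. real** (`ae_eq_zero_of_forall_integral_mul_eq_zero`). [folklore] -/
theorem im_ae_eq_zero_of_mFourierCoeff {v : UnitAddTorus d → ℝ} (hv : MemLp v 2 volume)
    {g : UnitAddTorus d → ℂ} (hg : MemLp g 2 volume) (j : d)
    (hcoeff : ∀ k : d → ℤ, mFourierCoeff g k =
      (2 * Real.pi * Complex.I * (k j) : ℂ) * mFourierCoeff (fun x => (v x : ℂ)) k) :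
    (fun x => (g x).im) =ᵐ[volume] 0 := by
  haveI : IsFiniteMeasure (volume : Measure (UnitAddTorus d)) := inferInstance
  refine ae_eq_zero_of_forall_integral_mul_eq_zero (Complex.imCLM.comp_memLp' hg) fun φ hφ => ?_
  have h := congrArg Complex.im (ofReal_integral_partialDeriv_mul_eq hv hg j hcoeff hφ)
  have hint : Integrable (fun x => (φ x : ℂ) * g x) volume := by
    have := hφ.integrable_smul (hg.integrable one_le_two)
    simpa [Complex.real_smul] using this
  rw [Complex.ofReal_im, Complex.neg_im, ← RCLike.im_eq_complex_im, ← integral_im hint,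
    eq_comm, neg_eq_zero] at h
  rw [← h]
  refine integral_congr_ae (ae_of_all _ fun x => ?_)
  simp

/-- The a.e.-real `L²` function `g` and its real part have the same modulus a.e.:
`(Re g)² = ‖g‖²` a.e. [folklore] -/
theorem re_sq_ae_eq_norm_sq_of_mFourierCoeff {v : UnitAddTorus d → ℝ} (hv : MemLp v 2 volume)
    {g : UnitAddTorus d → ℂ} (hg : MemLp g 2 volume) (j : d)
    (hcoeff : ∀ k : d → ℤ, mFourierCoeff g k =
      (2 * Real.pi * Complex.I * (k j) : ℂ) * mFourierCoeff (fun x => (v x : ℂ)) k) :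
    (fun x => (g x).re ^ 2) =ᵐ[volume] fun x => ‖g x‖ ^ 2 := by
  filter_upwards [im_ae_eq_zero_of_mFourierCoeff hv hg j hcoeff] with x hx
  simp only [Pi.zero_apply] at hx
  rw [Complex.sq_norm, Complex.normSq_apply, hx]
  ring

/-- **Vector form**: for `v ∈ L²(T^d; ℝ^d)` and `gᵢ ∈ L²(T^d; ℂ)` with `ĝᵢ(k) = 2πi kⱼ v̂ᵢ(k)`
(`v̂ᵢ` the coefficients of the `i`-th component), the real vector field `x ↦ ∑ᵢ Re gᵢ(x) eᵢ` is
a weak `j`-th partial derivative of `v` in the sense of `Torus.HasWeakPartialDeriv`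
(componentwise from `integral_partialDeriv_mul_eq_neg_integral_mul_re`; Evans, §5.2.1;
Grafakos 2014, Prop. 3.2.6 (8)). [cite: Grafakos2014, Prop. 3.2.6 (8)] -/
theorem hasWeakPartialDeriv_of_mFourierCoeff {v : UnitAddTorus d → EuclideanSpace ℝ d}
    (hv : MemLp v 2 volume) {g : d → UnitAddTorus d → ℂ} (hg : ∀ i, MemLp (g i) 2 volume) (j : d)
    (hcoeff : ∀ i (k : d → ℤ), mFourierCoeff (g i) k =
      (2 * Real.pi * Complex.I * (k j) : ℂ) * mFourierCoeff (fun x => (v x i : ℂ)) k) :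
    HasWeakPartialDeriv j v
      (fun x => ∑ i, (g i x).re • EuclideanSpace.single i (1 : ℝ)) := by
  haveI : IsFiniteMeasure (volume : Measure (UnitAddTorus d)) := inferInstance
  intro φ hφ
  set w : UnitAddTorus d → EuclideanSpace ℝ d :=
    fun x => ∑ i, (g i x).re • EuclideanSpace.single i (1 : ℝ) with hw_def
  have hw_apply : ∀ x i, w x i = (g i x).re := by
    intro x i
    simp [hw_def, Finset.sum_apply, Pi.single_apply]
  have hgi : ∀ i, Integrable (fun x => (g i x).re) volume := fun i =>
    (Complex.reCLM.comp_memLp' (hg i)).integrable one_le_two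
  have hwi : Integrable w volume := by
    refine Integrable.of_eval_piLp fun i => ?_
    simp_rw [hw_apply]
    exact hgi i
  have hvi : Integrable v volume := hv.integrable one_le_two
  have hL : ∀ i, Integrable (fun x => (partialDeriv j φ x • v x) i) volume := fun i =>
    ((hφ.partialDeriv j).integrable_smul hvi).eval_piLp i
  have hR : ∀ i, Integrable (fun x => (φ x • w x) i) volume := fun i =>
    (hφ.integrable_smul hwi).eval_piLp i
  ext i
  rw [eval_integral_piLp hL i, WithLp.ofLp_neg, Pi.neg_apply, eval_integral_piLp hR i]
  simp only [PiLp.smul_apply, smul_eq_mul, hw_apply]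
  exact integral_partialDeriv_mul_eq_neg_integral_mul_re (hv.eval_piLp i) (hg i) j (hcoeff i) hφ

end WeakDeriv

/-! ## The `L²` mass of the weak gradient is the spectral dissipation -/

section Norm

/-- **Parseval in `ℝ≥0∞`** for scalar `L²` functions: `∑' ‖ĝ(k)‖ₑ² = ∫⁻ ‖g‖ₑ²`
(Grafakos 2014, Prop. 3.2.7 (3)). [cite: Grafakos2014, Prop. 3.2.7 (3)] -/
theorem tsum_enorm_sq_mFourierCoeff {g : UnitAddTorus d → ℂ} (hg : MemLp g 2 volume) :
    ∑' k : d → ℤ, ‖mFourierCoeff g k‖ₑ ^ 2 = ∫⁻ x, ‖g x‖ₑ ^ 2 := by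
  have h := hasSum_sq_norm_mFourierCoeff hg
  have hlhs : ∑' k : d → ℤ, ‖mFourierCoeff g k‖ₑ ^ 2 = ENNReal.ofReal (∫ x, ‖g x‖ ^ 2) := by
    rw [← h.tsum_eq, ENNReal.ofReal_tsum_of_nonneg (fun k => sq_nonneg _) h.summable]
    refine tsum_congr fun k => ?_
    rw [← ofReal_norm, ← ENNReal.ofReal_pow (norm_nonneg _)]
  have hrhs : ENNReal.ofReal (∫ x, ‖g x‖ ^ 2) = ∫⁻ x, ‖g x‖ₑ ^ 2 := by
    rw [ofReal_integral_eq_lintegral_ofReal (hg.integrable_norm_pow two_ne_zero)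
      (ae_of_all _ fun x => by positivity)]
    refine lintegral_congr fun x => ?_
    rw [← ofReal_norm, ← ENNReal.ofReal_pow (norm_nonneg _)]
  rw [hlhs, hrhs]

omit [Fintype d] in
/-- `‖2πi m‖ₑ² = ofReal (4π²) · ofReal (m²)` for an integer frequency `m`. [folklore] -/
theorem _root_.Literature.Analysis.FunctionSpaces.enorm_sq_two_pi_I_mul (m : ℤ) :
    ‖(2 * (Real.pi : ℂ) * Complex.I * (m : ℂ))‖ₑ ^ 2 =
      ENNReal.ofReal (4 * Real.pi ^ 2) * ENNReal.ofReal ((m : ℝ) ^ 2) := by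
  rw [← ofReal_norm, ← ENNReal.ofReal_pow (norm_nonneg _), ← ENNReal.ofReal_mul (by positivity)]
  congr 1
  simp only [norm_mul, Complex.norm_ofNat, Complex.norm_real, Real.norm_eq_abs,
    Complex.norm_I, mul_one, Complex.norm_intCast, abs_of_pos Real.pi_pos]
  rw [mul_pow, mul_pow, sq_abs]
  ring

/-- The squared norm of a vector of `ℂ^d` in `ℝ≥0∞`: `‖w‖ₑ² = ∑ᵢ ‖wᵢ‖ₑ²`. [folklore] -/
theorem enorm_sq_eq_sum_euclidean {ι : Type*} [Fintype ι] (w : EuclideanSpace ℂ ι) :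
    ‖w‖ₑ ^ 2 = ∑ i, ‖w i‖ₑ ^ 2 := by
  rw [← ofReal_norm, ← ENNReal.ofReal_pow (norm_nonneg _), EuclideanSpace.norm_sq_eq,
    ENNReal.ofReal_sum_of_nonneg fun i _ => sq_nonneg _]
  refine Finset.sum_congr rfl fun i _ => ?_
  rw [← ofReal_norm, ← ENNReal.ofReal_pow (norm_nonneg _)]

/-- The spectral squared gradient norm, unfolded: `eGradNormSq v = 4π² ∑ₖ |k|² ‖𝓕(complexify ∘ v)(k)‖²`
(the omitted zero mode of `eHomSobolevSeminorm` contributes `|0|² = 0` anyway). [folklore] -/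
theorem eGradNormSq_eq_tsum (v : UnitAddTorus d → EuclideanSpace ℝ d) :
    eGradNormSq v = ENNReal.ofReal (4 * Real.pi ^ 2) *
      ∑' k : d → ℤ, ENNReal.ofReal (freqNormSq k) *
        ‖mFourierCoeff (EuclideanSpace.complexify ∘ v) k‖ₑ ^ 2 := by
  rw [eGradNormSq, eHomSobolevSeminorm, ENNReal.rpow_half_sq]
  congr 1
  refine tsum_congr fun k => ?_
  by_cases hk : k = 0
  · subst hk
    simp [freqNormSq]
  · rw [if_neg hk, Real.rpow_one]

/-- **The `L²` mass of the weak gradient is the spectral dissipation**: if `v ∈ L²(T^d; ℝ^d)` and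
`gᵢⱼ ∈ L²` have coefficients `ĝᵢⱼ(k) = 2πi kⱼ v̂ᵢ(k)`, then `∫ ∑ᵢⱼ ‖gᵢⱼ‖² = eGradNormSq v`
(`= 4π² ∑ₖ |k|² ‖v̂(k)‖²`; Parseval termwise and `|k|² = ∑ⱼ kⱼ²`, `‖v̂(k)‖² = ∑ᵢ |v̂ᵢ(k)|²`;
Grafakos 2014, Prop. 3.2.6 (8), Prop. 3.2.7 (3); Doering–Foias 2002, §2). [cite: Grafakos2014, Prop. 3.2.7 (3)] -/
theorem lintegral_sum_enorm_sq_eq_eGradNormSq {v : UnitAddTorus d → EuclideanSpace ℝ d}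
    (hv : MemLp v 2 volume) {g : d → d → UnitAddTorus d → ℂ} (hg : ∀ i j, MemLp (g i j) 2 volume)
    (hcoeff : ∀ i j (k : d → ℤ), mFourierCoeff (g i j) k =
      (2 * Real.pi * Complex.I * (k j) : ℂ) * mFourierCoeff (fun x => (v x i : ℂ)) k) :
    ∫⁻ x, ∑ i, ∑ j, ‖g i j x‖ₑ ^ 2 = eGradNormSq v := by
  haveI : IsFiniteMeasure (volume : Measure (UnitAddTorus d)) := inferInstance
  have hvi : Integrable v volume := hv.integrable one_le_two
  set C : ℝ≥0∞ := ENNReal.ofReal (4 * Real.pi ^ 2) with hC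
  set A : (d → ℤ) → d → ℝ≥0∞ := fun k j => ENNReal.ofReal ((k j : ℝ) ^ 2) with hA
  set B : (d → ℤ) → d → ℝ≥0∞ := fun k i => ‖mFourierCoeff (fun x => (v x i : ℂ)) k‖ₑ ^ 2 with hB
  -- Parseval termwise
  have hij : ∀ i j, ∫⁻ x, ‖g i j x‖ₑ ^ 2 = ∑' k, C * A k j * B k i := by
    intro i j
    rw [← tsum_enorm_sq_mFourierCoeff (hg i j)]
    refine tsum_congr fun k => ?_
    rw [hcoeff i j k, enorm_mul, mul_pow, enorm_sq_two_pi_I_mul]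
  -- `|k|² = ∑ⱼ kⱼ²` and `‖v̂(k)‖² = ∑ᵢ |v̂ᵢ(k)|²`
  have hfreq : ∀ k : d → ℤ, ENNReal.ofReal (freqNormSq k) = ∑ j, A k j := fun k => by
    rw [freqNormSq, ENNReal.ofReal_sum_of_nonneg fun j _ => sq_nonneg _]
  have hnorm : ∀ k : d → ℤ, ‖mFourierCoeff (EuclideanSpace.complexify ∘ v) k‖ₑ ^ 2 =
      ∑ i, B k i := fun k => by
    rw [enorm_sq_eq_sum_euclidean]
    refine Finset.sum_congr rfl fun i _ => ?_
    rw [mFourierCoeff_complexify_apply hvi k i]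
  -- swap the integral with the finite sums and the finite sums with the series
  calc ∫⁻ x, ∑ i, ∑ j, ‖g i j x‖ₑ ^ 2 = ∑ i, ∑ j, ∫⁻ x, ‖g i j x‖ₑ ^ 2 := by
        rw [lintegral_finsetSum' _ fun i _ =>
          Finset.aemeasurable_fun_sum _ fun j _ => (hg i j).1.enorm.pow_const 2]
        refine Finset.sum_congr rfl fun i _ => ?_
        rw [lintegral_finsetSum' _ fun j _ => (hg i j).1.enorm.pow_const 2]
    _ = ∑ i, ∑ j, ∑' k, C * A k j * B k i := by simp_rw [hij]
    _ = ∑' k, ∑ i, ∑ j, C * A k j * B k i := by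
        simp_rw [← Summable.tsum_finsetSum fun _ _ => ENNReal.summable]
    _ = ∑' k, C * (ENNReal.ofReal (freqNormSq k) *
          ‖mFourierCoeff (EuclideanSpace.complexify ∘ v) k‖ₑ ^ 2) := by
        refine tsum_congr fun k => ?_
        rw [hfreq, hnorm, Finset.sum_mul, Finset.mul_sum, Finset.sum_comm]
        refine Finset.sum_congr rfl fun j _ => ?_
        rw [Finset.mul_sum, Finset.mul_sum]
        refine Finset.sum_congr rfl fun i _ => ?_
        ring
    _ = eGradNormSq v := by rw [eGradNormSq_eq_tsum, ENNReal.tsum_mul_left]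

end Norm

end Torus

end Literature.Analysis.FunctionSpaces
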